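import Summits.BirchSwinnertonDyer.BirchSwinnertonDyer.Theorems.ErratumRoadFiveOpenInputIMCReduction
import Summits.BirchSwinnertonDyer.BirchSwinnertonDyer.Theorems.ClassRecordThreeNormRigidityOneSided
import Summits.BirchSwinnertonDyer.Rank1Residual.X11b.BDPRouteIntSeriesContinuity
import Summits.BirchSwinnertonDyer.Rank1Residual.X11b.UnrIntegersValuationRing
import Summits.BirchSwinnertonDyer.Rank1Residual.X11b.PadicComplexInertiaFixed
import HarnessLib

/-!
# Route `ErratumRoadFive` (K2 at `p ≥ 5`), items 19275 `BDPValueCoreFramesAll` (H2) and 19061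
# `OpenInputIMC`: on the erratum road the VALUE AT `𝟙` is NOT an independent Λ-adic input — it is
# forced onto the H3 side's own ♭-frame by NORM CONTINUITY AT `𝟙` of Castella's displays (VN_p)

Cell `bsd-stepL` (run/shared/lean/pub/bsd-stepL/), seat `bsd-stepL-bdp` (prover g11, 2026-08-26),
`--supports stmt-BirchSwinnertonDyer-19275`. The `p ≥ 5` / erratum-data twin of thmc-p1's `p = 3`
files `Theorems/ClassRecordThreeHalvesAtThreeNormContinuity.lean` (p428541) and
`Theorems/ClassRecordThreeNormRigidityOneSided.lean` (p427664, whose one-sided NORM rigidity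
`intSeries_norm_constantCoeff_eq_of_isBDPLFunctionInt_of_continuousNorms` — every odd `p` — is the
only analytic input here).

## The statement (VN_p) «norm continuity at `𝟙` at the erratum data of `(W, p)`»

Binder for binder the erratum data of `P2.IMCDivIntCoreFrameAtErratumData W p` ∕
`R1.BDPValueCoreFrameOnTree W p` (the A′-hypotheses `ErratumHypotheses W p`, `r_an = 1`, the non-split
multiplicative `q ≠ p` with `E[p]` ramified, an erratum field `K` for `q` with [Cas20]'s standing
hypotheses, a parametrisation datum `Dt` with `p ∤ c`, a Heegner datum `H`, the point `P` of infinite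
order read through `w₀`, every anticyclotomic `(κ, γ)`, every `ι'` and every `e : K → ℚ_p` inducing
`𝔭_{ι'}`), with conclusion: THERE ARE virtual periods `Ω_K ≠ 0`, `Ω_p ≠ 0` (in `ℂ` and `ℂ_p`; no
`R₀`-membership) such that along EVERY interpolation sequence `(φ_k, n_k, r_k)` (everywhere
unramified `φ_k` of infinity type `(n_k, −n_k)`, `n_k > 0`, avatars `r_k` through `κ`, `r_k(γ) → 1`) the
NORMS `‖ι'⁻¹(bdpInterpolationValue p f_{Dt} 𝔭_{ι'} φ_k n_k Ω_K)·Ω_p^{4n_k}‖` tend to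
`‖(1 − a_p(E)·p⁻¹)·log_{ω_E} P‖²` (`log_{ω_E} P = logOmega W p e P`). It is stated INLINE (no
definition) as the section hypothesis `hVN` ∕ `hVNall`. (VN_p) carries NO unit, NO `R₀`, NO `p`-adic
`L`-function: only `p`-adic absolute values of Castella-normalised complex central values near `𝟙`.

## What this file proves (theorems only; no definition, no named fact, no `sorry`)

1. `imcDivIntFrameAtErratumData_of_normContinuity_of_core`: TARGET E of the cell
   (`P2.IMCDivIntFrameAtErratumData W p`: ♭-frame + interpolation + VALUE + divisibility) ⟸ the
   value-free core `P2.IMCDivIntCoreFrameAtErratumData W p` (item 19270's text at `(W,p)`) + (VN_p):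
   the ♭-frame `Q` the H3 side supplies has `‖[T⁰]Q‖ = ‖(1 − a_p p⁻¹)·log_{ω_E} P‖²` by one-sided norm
   rigidity, and `u := [T⁰]Q / ((1 − a_p p⁻¹)·log_{ω_E} P)²` has norm one. NO H2, NO `R₀`-frame.
2. `bdpValueCoreFrameOnTree_of_normContinuity_of_frames`: H2∃⁻ itself
   (`R1.BDPValueCoreFrameOnTree W p`, item 19275 at `(W,p)`) ⟸ (VN_p) + «an `R₀`-frame with Castella's
   interpolation property exists at every erratum datum» (H1∃⁻); the unit `u ∈ R₀ˣ` is automatic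
   because `R₀` is the valuation ring of `Frac R₀ ∋ log_{ω_E} P`
   (`exists_unit_unrIntegers_mul_eq_of_norm_eq`).
3. `valueContinuityAtErratumData_of_bdpValueCoreFrame` and
   `normContinuityAtErratumData_of_valueContinuity`: H2∃⁻ ⟹ (VC_p) (value continuity, with a `u` of
   norm one) ⟹ (VN_p). So (VN_p) is WEAKER than item 19275's text: a restate loses nothing.
4. The class ∕ route level (item 19061's glue with the H2 child 19275 REPLACED by (VN_p ∀); item
   19275 ⟺ (VN_p ∀) modulo frame existence) is the sequel
   `Theorems/ErratumRoadFiveOpenInputIMCOfNormContinuity.lean`.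

CONSEQUENCE FOR THE SEAT'S QUESTION («the Λ^ur-INTEGRAL, CJM18-normalised BDP element at p ∥ N WITH
its value formula at 𝟙»): on the erratum road at `p ≥ 5` the integral element need not carry the
value — `R₀`-integrality of a BDP element at a NON-semistable `p ∥ N` (printed nowhere: Cas18 Thm.
3.1 is semistable, JIMJ18 Thms. 2.10–2.11 give a CONTINUOUS function only) drops out of the road; what
the road consumes from the analytic side is (VN_p), whose printed status is: Cas18 Thm. 3.2 on
semistable pairs; JIMJ18 (Castella, J. Inst. Math. Jussieu 17 (2018)) Thms. 2.10–2.11 + BDP13 §4.1 ∕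
§5 at `p ≥ 5` for any conductor at the data where BDP13's auxiliary sign condition holds (cell memo
PROOF-BDP §21 THEOREM C♯ ∕ §28). HONEST FRAMING: every theorem is an implication; (VN_p) is NOT
discharged here; H3 (19270) is OPEN (PREPRINT-derived); nothing is booked; no pair of class X11b is
closed; no label or census count moves (T7).

References: [Castella2018] arXiv:1704.06608 Thms. 3.1–3.2, §5; [Castella2018Exceptional] arXiv:1507.04260
Thms. 2.10–2.11; [BertoliniDarmonPrasanna2013] §4.1, Prop. 5.10, Thm. 5.13; [Castella2018Erratum] (2.4).
-/

set_option autoImplicit false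

noncomputable section

open scoped Classical Topology
open Filter WeierstrassCurve NumberField IsDedekindDomain Field PowerSeries
open Literature.NumberTheory.EllipticCurves Literature.NumberTheory.EllipticCurves.GreenbergSelmer
open Literature.NumberTheory.EllipticCurves.ModularForms
open Literature.NumberTheory.EllipticCurves.Rank1Residual
open Literature.NumberTheory.EllipticCurves.Rank1Residual.Typed
open Literature.NumberTheory.EllipticCurves.Castella2018
open Literature.NumberTheory.GaloisRepresentations
open Literature.NumberTheory.GaloisCohomology
open Summit.BirchSwinnertonDyer.Rank1Residual Summit.BirchSwinnertonDyer.Rank1Residual.X11b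
open Summit.BirchSwinnertonDyer.Rank1Residual.X11b.Halves
open Summit.BirchSwinnertonDyer.BirchSwinnertonDyer.Theses

namespace Summit.BirchSwinnertonDyer.BirchSwinnertonDyer.Theorems

/-! ### §0 Two elementary lemmas -/

section Elementary

variable {p : ℕ} [Fact p.Prime]

/-- **The BDP value target is non-zero at a multiplicative prime**: `(1 − a·p⁻¹)·x ≠ 0` in `ℚ_p` for
`a = ±1` (the `a_p` of a newform at a prime dividing the level exactly) and `x ≠ 0` (the logarithm of
a point of infinite order). [folklore] -/
theorem one_sub_mul_inv_mul_ne_zero {a : ℤ} (ha : a = 1 ∨ a = -1) {x : ℚ_[p]} (hx : x ≠ 0) :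
    ((1 : ℚ_[p]) - (a : ℚ_[p]) * (p : ℚ_[p])⁻¹) * x ≠ 0 := by
  have hp : p.Prime := Fact.out
  refine mul_ne_zero ?_ hx
  have hp0 : (p : ℚ_[p]) ≠ 0 := Nat.cast_ne_zero.mpr hp.ne_zero
  intro h
  have h' : (a : ℚ_[p]) = (p : ℚ_[p]) := by
    have := congrArg (· * (p : ℚ_[p])) h
    simp only [sub_mul, one_mul, zero_mul, inv_mul_cancel_right₀ hp0, sub_eq_zero] at this
    exact this.symm
  have h'' : (a : ℚ_[p]) = ((p : ℤ) : ℚ_[p]) := by rw [h']; norm_cast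
  have haZ : a = (p : ℤ) := Int.cast_injective h''
  have hp2 : (2 : ℤ) ≤ (p : ℤ) := by exact_mod_cast hp.two_le
  rcases ha with rfl | rfl <;> omega

/-- **A value "up to a unit of `R₀`" from a NORM identity.** For `c ∈ R₀` and a non-zero `x ∈ ℚ_p`
with `‖c‖ = ‖x‖` (read in `ℂ_p`) there is `u ∈ R₀ˣ` with `u·x = c`: `c/x ∈ Frac R₀` has norm one, lies in
`R₀` because `R₀` is the valuation ring of `Frac R₀` (`R1.mem_unrIntegers_of_mem_fracUnr`), and is a
unit there (`unrIntegers.isUnit_iff_norm_eq_one`). (The `p = 3` file proves the `↔` form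
`UnrSeries.exists_unit_hasValueAt_zero_iff_norm_eq`; restated here in the shape used, to keep this
route's module free of the `ClassRecordThree` route file.) [cite: Castella2018, §3 (p. 9) and Thm. 3.2 (R₀ and the unit in the value shape; the lemma is folklore)] -/
theorem exists_unit_unrIntegers_mul_eq_of_norm_eq (c : unrIntegers p) {x : ℚ_[p]} (hx : x ≠ 0)
    (h : ‖(c : ℂ_[p])‖ = ‖algebraMap ℚ_[p] ℂ_[p] x‖) :
    ∃ u : (unrIntegers p)ˣ, ((u : unrIntegers p) : ℂ_[p]) * algebraMap ℚ_[p] ℂ_[p] x = c := by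
  set y : ℂ_[p] := algebraMap ℚ_[p] ℂ_[p] x with hy
  have hy0 : y ≠ 0 := (map_ne_zero_iff _ (algebraMap ℚ_[p] ℂ_[p]).injective).mpr hx
  have hyF : y ∈ Subfield.closure (unrIntegers p : Set ℂ_[p]) := by
    rw [hy, IsScalarTower.algebraMap_apply ℚ_[p] (PadicAlgCl p) ℂ_[p] x]
    exact PadicComplexTransport.algebraMap_padic_mem_fracUnr p x
  have hw : (c : ℂ_[p]) / y ∈ Subfield.closure (unrIntegers p : Set ℂ_[p]) :=
    div_mem (Subfield.subset_closure c.2) hyF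
  have hw1 : ‖(c : ℂ_[p]) / y‖ = 1 := by
    rw [norm_div, h, div_self (norm_ne_zero_iff.mpr hy0)]
  have hwR : (c : ℂ_[p]) / y ∈ unrIntegers p := R1.mem_unrIntegers_of_mem_fracUnr hw hw1.le
  obtain ⟨u, hu⟩ := (unrIntegers.isUnit_iff_norm_eq_one ⟨(c : ℂ_[p]) / y, hwR⟩).mpr hw1
  refine ⟨u, ?_⟩
  rw [hu]
  exact div_mul_cancel₀ (c : ℂ_[p]) hy0

end Elementary

/-! ### §1 Pair level: TARGET E and H2∃⁻ from (VN_p) -/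

section Pair

variable {W : WeierstrassCurve ℚ} [W.IsElliptic] [W.IsGloballyMinimal] {p : ℕ} [Fact p.Prime]

variable
  (hVN : ∀ [NeZero (W.conductorNorm ℤ)] (q : ℕ) [Fact q.Prime] (K : Type) [Field K] [NumberField K]
    (Dt : ModularParametrizationData W (W.conductorNorm ℤ))
    (H : HeegnerDatum (W.conductorNorm ℤ) (NumberField.discr K)) (w₀ : InfinitePlace K)
    (P : (W.baseChange K).toAffine.Point), ErratumHypotheses W p → W.analyticRank = 1 →
    q ≠ p → Mult W q → ¬ W.HasSplitMultiplicativeReductionAtPrime q →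
    ¬ p ∣ padicValInt q W.minimalDiscriminantInt → IsErratumField W K q →
    Cas20Standing K p (W.conductorNorm ℤ / p) →
    WeierstrassCurve.Affine.Point.map w₀.embedding.toRatAlgHom P = heegnerPointComplex Dt H →
    ¬ (p : ℤ) ∣ Dt.c → ¬ IsOfFinAddOrder P →
    ∀ (κ : ZpExtension K p), κ.IsAnticyclotomic →
      ∀ (γ : Field.absoluteGaloisGroup K) [Fact (κ.IsTopGenerator γ)] (ι' : PadicAlgCl p ≃+* ℂ)
        (e : K →+* ℚ_[p]),
        (∀ k : 𝓞 K, k ∈ (primeOfEmbeddingDatum p ι' w₀.embedding).asIdeal ↔ ‖e (k : K)‖ < 1) →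
        ∃ (ΩK : ℂ) (Ωp : ℂ_[p]), ΩK ≠ 0 ∧ Ωp ≠ 0 ∧
          ∀ (φ : ℕ → HeckeCharacter K) (n : ℕ → ℕ) (r : ℕ → FramedGaloisRep K (PadicAlgCl p) 1),
            (∀ k, 0 < n k) → (∀ k (v : HeightOneSpectrum (𝓞 K)), (φ k).IsUnramifiedAt v) →
            (∀ k, (φ k).HasInfinityType (fun _ ↦ (n k : ℤ)) (fun _ ↦ -(n k : ℤ))) →
            (∀ k, IsPAdicAvatarOf ι' (φ k) (r k)) → (∀ k, FactorsThroughZp κ (r k)) →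
            Tendsto (fun k ↦ avatarValueAt (r k) γ) atTop (𝓝 1) →
            Tendsto (fun k ↦ ‖((ι'.symm (bdpInterpolationValue p Dt.f
                (primeOfEmbeddingDatum p ι' w₀.embedding) (φ k) (n k) ΩK) : PadicAlgCl p) : ℂ_[p]) *
              Ωp ^ (4 * n k)‖) atTop
              (𝓝 (‖algebraMap ℚ_[p] ℂ_[p] (((1 : ℚ_[p]) - ((W.LFunction p : ℤ) : ℚ_[p]) *
                (p : ℚ_[p])⁻¹) * logOmega W p e P)‖ ^ 2)))

include hVN

/-- **TARGET E from the value-free core + (VN_p).** At every erratum datum of `(W, p)` the core shape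
`P2.IMCDivIntCoreFrameAtErratumData W p` supplies a ♭-frame `(Ω_K, Ω_p, Q)` (`Q ∈ 𝓞_{ℂ_p}⟦T⟧`,
Castella's interpolation property, the divisibility); (VN_p) supplies virtual periods whose display
NORMS tend to `N₀ = ‖(1 − a_p p⁻¹)·log_{ω_E} P‖² ≠ 0` (`a_p = ±1` at the multiplicative `p`, `P` of
infinite order); one-sided norm rigidity (`intSeries_norm_constantCoeff_eq_of_isBDPLFunctionInt_of_continuousNorms`,
thmc-p1, odd `p`) gives `‖[T⁰]Q‖ = N₀`, whence the value conjunct `R1.BDPValueAtOneIntAt` with the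
norm-one scalar `u = [T⁰]Q/((1 − a_p p⁻¹)·log_{ω_E} P)²`. So the with-value shape
`P2.IMCDivIntFrameAtErratumData W p` (TARGET E) holds WITHOUT any H2 ∕ `R₀`-frame input.
CONDITIONAL on (VN_p) and on the core shape (OPEN, PREPRINT-derived).
[claim: Castella2018Erratum, status: under-review]
[cite: Castella2018, Thm. 3.1, display (3.2) and Thm. 3.2 (arXiv:1704.06608 p. 9) (shapes only)] -/
theorem imcDivIntFrameAtErratumData_of_normContinuity_of_core
    (h : P2.IMCDivIntCoreFrameAtErratumData W p) : P2.IMCDivIntFrameAtErratumData W p := by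
  intro _ q _ K _ _ Dt H w₀ P hE hr hqp hmq hns hvq hK hCas hP hc hinf κ hκ γ hγ ι' e he
  obtain ⟨ΩK, Ωp, Q, hΩ, hΩp, hQ, hdiv⟩ :=
    h q K Dt H w₀ P hE hr hqp hmq hns hvq hK hCas hP hc hinf κ hκ γ ι' e he
  obtain ⟨ΩK', Ωp', hΩK', hΩp', hcont⟩ :=
    hVN q K Dt H w₀ P hE hr hqp hmq hns hvq hK hCas hP hc hinf κ hκ γ ι' e he
  have hp2 : p ≠ 2 := hE.two_ne
  have hΩp0 : Ωp ≠ 0 := by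
    intro h0
    rw [h0, norm_zero] at hΩp
    exact zero_ne_one hΩp
  -- the target is non-zero
  have ha : W.LFunction p = 1 ∨ W.LFunction p = -1 :=
    Three.lFunction_eq_one_or_eq_neg_one_of_isNewformOf W Dt.isNewformOf hE.2.1
  set x : ℚ_[p] := ((1 : ℚ_[p]) - ((W.LFunction p : ℤ) : ℚ_[p]) * (p : ℚ_[p])⁻¹) * logOmega W p e P
    with hxdef
  have hx : x ≠ 0 := one_sub_mul_inv_mul_ne_zero ha (R1.logOmega_ne_zero W p e hinf)
  set y : ℂ_[p] := algebraMap ℚ_[p] ℂ_[p] x with hydef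
  have hy0 : y ≠ 0 := (map_ne_zero_iff _ (algebraMap ℚ_[p] ℂ_[p]).injective).mpr hx
  have hN0 : ‖y‖ ^ 2 ≠ 0 := pow_ne_zero _ (norm_ne_zero_iff.mpr hy0)
  -- one-sided norm rigidity at the H3 side's frame
  have key := intSeries_norm_constantCoeff_eq_of_isBDPLFunctionInt_of_continuousNorms hp2 hK.1 hκ
    hγ.out hΩK' hΩ hΩp' hΩp0 hcont hN0 hQ
  refine ⟨ΩK, Ωp, Q, hΩ, hΩp, hQ, ?_, hdiv⟩
  -- the value conjunct with the norm-one scalar `[T⁰]Q / y²`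
  set c : ℂ_[p] := ((PowerSeries.constantCoeff Q : 𝓞_ℂ_[p]) : ℂ_[p]) with hcdef
  have hy2 : y ^ 2 ≠ 0 := pow_ne_zero _ hy0
  refine ⟨c / y ^ 2, ?_, ?_⟩
  · rw [norm_div, norm_pow, key, div_self hN0]
  · rw [div_mul_cancel₀ c hy2]
    exact R1.intSeries_hasValueAt_zero p Q

/-- **H2∃⁻ (item 19275's text at `(W,p)`) from (VN_p) + frame existence (H1∃⁻).** If at every erratum
datum and every `ι'` SOME `R₀`-frame `(Ω_K ≠ 0, Ω_p ∈ R₀ˣ, L ∈ R₀⟦T⟧)` with Castella's interpolation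
property exists, then (VN_p) upgrades it to a frame WITH the value `L(𝟙) = u·((1 − a_p p⁻¹)·log_{ω_E} P)²`,
`u ∈ R₀ˣ`: norm rigidity gives `‖[T⁰]L‖ = ‖((1 − a_p p⁻¹)·log_{ω_E} P)²‖`, and the unit is automatic
(`exists_unit_unrIntegers_mul_eq_of_norm_eq`: `[T⁰]L ∈ R₀`, the target lies in `ℚ_p ⊆ Frac R₀`).
CONDITIONAL on (VN_p) and on H1∃⁻ (print on semistable pairs: Cas18 Thm. 3.1; memo THEOREM C♯ in general).
[cite: Castella2018, Thm. 3.1, display (3.2) and Thm. 3.2 (arXiv:1704.06608 p. 9) (shapes only)] -/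
theorem bdpValueCoreFrameOnTree_of_normContinuity_of_frames
    (hF : ∀ [NeZero (W.conductorNorm ℤ)] (q : ℕ) [Fact q.Prime] (K : Type) [Field K] [NumberField K]
      (Dt : ModularParametrizationData W (W.conductorNorm ℤ))
      (H : HeegnerDatum (W.conductorNorm ℤ) (NumberField.discr K)) (w₀ : InfinitePlace K)
      (P : (W.baseChange K).toAffine.Point), ErratumHypotheses W p → W.analyticRank = 1 →
      q ≠ p → Mult W q → ¬ W.HasSplitMultiplicativeReductionAtPrime q →
      ¬ p ∣ padicValInt q W.minimalDiscriminantInt → IsErratumField W K q →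
      Cas20Standing K p (W.conductorNorm ℤ / p) →
      WeierstrassCurve.Affine.Point.map w₀.embedding.toRatAlgHom P = heegnerPointComplex Dt H →
      ¬ (p : ℤ) ∣ Dt.c → ¬ IsOfFinAddOrder P →
      ∀ (κ : ZpExtension K p), κ.IsAnticyclotomic →
        ∀ (γ : Field.absoluteGaloisGroup K) [Fact (κ.IsTopGenerator γ)] (ι' : PadicAlgCl p ≃+* ℂ)
          (e : K →+* ℚ_[p]),
          (∀ k : 𝓞 K, k ∈ (primeOfEmbeddingDatum p ι' w₀.embedding).asIdeal ↔ ‖e (k : K)‖ < 1) →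
          ∃ (ΩK : ℂ) (Ωp : (unrIntegers p)ˣ) (L : UnrSeries p), ΩK ≠ 0 ∧
            IsBDPLFunction ι' (primeOfEmbeddingDatum p ι' w₀.embedding) κ γ Dt.f ΩK
              ((Ωp : unrIntegers p) : ℂ_[p]) L) :
    R1.BDPValueCoreFrameOnTree W p := by
  intro _ q _ K _ _ Dt H w₀ P hE hr hqp hmq hns hvq hK hCas hP hc hinf κ hκ γ hγ ι' e he
  obtain ⟨ΩK, Ωp, L, hΩ, hL⟩ :=
    hF q K Dt H w₀ P hE hr hqp hmq hns hvq hK hCas hP hc hinf κ hκ γ ι' e he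
  obtain ⟨ΩK', Ωp', hΩK', hΩp', hcont⟩ :=
    hVN q K Dt H w₀ P hE hr hqp hmq hns hvq hK hCas hP hc hinf κ hκ γ ι' e he
  have hp2 : p ≠ 2 := hE.two_ne
  have hΩp0 : ((Ωp : unrIntegers p) : ℂ_[p]) ≠ 0 := by
    rw [Ne, ZeroMemClass.coe_eq_zero]
    exact Units.ne_zero Ωp
  have ha : W.LFunction p = 1 ∨ W.LFunction p = -1 :=
    Three.lFunction_eq_one_or_eq_neg_one_of_isNewformOf W Dt.isNewformOf hE.2.1
  set x : ℚ_[p] := ((1 : ℚ_[p]) - ((W.LFunction p : ℤ) : ℚ_[p]) * (p : ℚ_[p])⁻¹) * logOmega W p e P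
    with hxdef
  have hx : x ≠ 0 := one_sub_mul_inv_mul_ne_zero ha (R1.logOmega_ne_zero W p e hinf)
  have hx2 : x ^ 2 ≠ 0 := pow_ne_zero _ hx
  set y : ℂ_[p] := algebraMap ℚ_[p] ℂ_[p] x with hydef
  have hy0 : y ≠ 0 := (map_ne_zero_iff _ (algebraMap ℚ_[p] ℂ_[p]).injective).mpr hx
  have hN0 : ‖y‖ ^ 2 ≠ 0 := pow_ne_zero _ (norm_ne_zero_iff.mpr hy0)
  -- the frame read in `𝓞_{ℂ_p}⟦T⟧`, and norm rigidity there
  have hQ := R1.isBDPLFunctionInt_map hL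
  have key := intSeries_norm_constantCoeff_eq_of_isBDPLFunctionInt_of_continuousNorms hp2 hK.1 hκ
    hγ.out hΩK' hΩ hΩp' hΩp0 hcont hN0 hQ
  have hcoe : ((PowerSeries.constantCoeff (PowerSeries.map (R1.unrToCpInt p) L) : 𝓞_ℂ_[p]) : ℂ_[p]) =
      ((PowerSeries.constantCoeff L : unrIntegers p) : ℂ_[p]) := by
    rw [← PowerSeries.coeff_zero_eq_constantCoeff_apply, PowerSeries.coeff_map,
      PowerSeries.coeff_zero_eq_constantCoeff_apply, R1.coe_unrToCpInt]
  rw [hcoe, ← norm_pow, hydef, ← map_pow] at key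
  -- the unit is automatic
  obtain ⟨u, hu⟩ := exists_unit_unrIntegers_mul_eq_of_norm_eq (PowerSeries.constantCoeff L) hx2 key
  refine ⟨ΩK, Ωp, L, hΩ, hL, u, ?_⟩
  rw [map_pow] at hu
  rw [hu]
  exact L.hasValueAt_zero

end Pair

/-! ### §2 (VN_p) is weaker than H2∃⁻: H2∃⁻ ⟹ (VC_p) ⟹ (VN_p) -/

section Weaker

variable {W : WeierstrassCurve ℚ} [W.IsElliptic] [W.IsGloballyMinimal] {p : ℕ} [Fact p.Prime]

/-- **H2∃⁻ ⟹ (VC_p) (value continuity at `𝟙` at the erratum data).** The frame's own periods serve as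
virtual periods: its display values ARE the values of `L` at `r_k(γ) − 1 → 0`, and these tend to
`[T⁰]L = u·((1 − a_p p⁻¹)·log_{ω_E} P)²` (`intSeries_tendsto_value_of_tendsto_zero`), `‖u‖ = 1`.
[cite: Castella2018, Thm. 3.1–3.2 (arXiv:1704.06608 p. 9) (shapes only)] -/
theorem valueContinuityAtErratumData_of_bdpValueCoreFrame (h2 : R1.BDPValueCoreFrameOnTree W p) :
    ∀ [NeZero (W.conductorNorm ℤ)] (q : ℕ) [Fact q.Prime] (K : Type) [Field K] [NumberField K]
      (Dt : ModularParametrizationData W (W.conductorNorm ℤ))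
      (H : HeegnerDatum (W.conductorNorm ℤ) (NumberField.discr K)) (w₀ : InfinitePlace K)
      (P : (W.baseChange K).toAffine.Point), ErratumHypotheses W p → W.analyticRank = 1 →
      q ≠ p → Mult W q → ¬ W.HasSplitMultiplicativeReductionAtPrime q →
      ¬ p ∣ padicValInt q W.minimalDiscriminantInt → IsErratumField W K q →
      Cas20Standing K p (W.conductorNorm ℤ / p) →
      WeierstrassCurve.Affine.Point.map w₀.embedding.toRatAlgHom P = heegnerPointComplex Dt H →
      ¬ (p : ℤ) ∣ Dt.c → ¬ IsOfFinAddOrder P →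
      ∀ (κ : ZpExtension K p), κ.IsAnticyclotomic →
        ∀ (γ : Field.absoluteGaloisGroup K) [Fact (κ.IsTopGenerator γ)] (ι' : PadicAlgCl p ≃+* ℂ)
          (e : K →+* ℚ_[p]),
          (∀ k : 𝓞 K, k ∈ (primeOfEmbeddingDatum p ι' w₀.embedding).asIdeal ↔ ‖e (k : K)‖ < 1) →
          ∃ (ΩK : ℂ) (Ωp : ℂ_[p]) (u : ℂ_[p]), ΩK ≠ 0 ∧ Ωp ≠ 0 ∧ ‖u‖ = 1 ∧
            ∀ (φ : ℕ → HeckeCharacter K) (n : ℕ → ℕ) (r : ℕ → FramedGaloisRep K (PadicAlgCl p) 1),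
              (∀ k, 0 < n k) → (∀ k (v : HeightOneSpectrum (𝓞 K)), (φ k).IsUnramifiedAt v) →
              (∀ k, (φ k).HasInfinityType (fun _ ↦ (n k : ℤ)) (fun _ ↦ -(n k : ℤ))) →
              (∀ k, IsPAdicAvatarOf ι' (φ k) (r k)) → (∀ k, FactorsThroughZp κ (r k)) →
              Tendsto (fun k ↦ avatarValueAt (r k) γ) atTop (𝓝 1) →
              Tendsto (fun k ↦ ((ι'.symm (bdpInterpolationValue p Dt.f
                  (primeOfEmbeddingDatum p ι' w₀.embedding) (φ k) (n k) ΩK) : PadicAlgCl p) : ℂ_[p]) *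
                Ωp ^ (4 * n k)) atTop
                (𝓝 (u * (algebraMap ℚ_[p] ℂ_[p] (((1 : ℚ_[p]) - ((W.LFunction p : ℤ) : ℚ_[p]) *
                  (p : ℚ_[p])⁻¹) * logOmega W p e P)) ^ 2)) := by
  intro _ q _ K _ _ Dt H w₀ P hE hr hqp hmq hns hvq hK hCas hP hc hinf κ hκ γ hγ ι' e he
  obtain ⟨ΩK, Ωp, L, hΩ, hL, u, hu⟩ :=
    h2 q K Dt H w₀ P hE hr hqp hmq hns hvq hK hCas hP hc hinf κ hκ γ ι' e he
  have hΩp0 : ((Ωp : unrIntegers p) : ℂ_[p]) ≠ 0 := by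
    rw [Ne, ZeroMemClass.coe_eq_zero]
    exact Units.ne_zero Ωp
  refine ⟨ΩK, ((Ωp : unrIntegers p) : ℂ_[p]), ((u : unrIntegers p) : ℂ_[p]), hΩ, hΩp0,
    norm_coe_units_unrIntegers p u, ?_⟩
  intro φ n r hn hunr hinf' hr hrκ hlim
  have hvals : ∀ k, IntSeries.HasValueAt (PowerSeries.map (R1.unrToCpInt p) L)
      (avatarValueAt (r k) γ - 1)
      (((ι'.symm (bdpInterpolationValue p Dt.f (primeOfEmbeddingDatum p ι' w₀.embedding) (φ k) (n k)
        ΩK) : PadicAlgCl p) : ℂ_[p]) * ((Ωp : unrIntegers p) : ℂ_[p]) ^ (4 * n k)) := fun k ↦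
    (R1.intSeries_hasValueAt_map_iff p L _ _).mpr
      (hL (φ k) (n k) (hn k) (hunr k) (hinf' k) (r k) (hr k) (hrκ k))
  have hT0 : Tendsto (fun k ↦ avatarValueAt (r k) γ - 1) atTop (𝓝 0) := by
    simpa using hlim.sub_const 1
  have hlimv := intSeries_tendsto_value_of_tendsto_zero hT0 hvals
  have hcoe : ((PowerSeries.constantCoeff (PowerSeries.map (R1.unrToCpInt p) L) : 𝓞_ℂ_[p]) : ℂ_[p]) =
      ((PowerSeries.constantCoeff L : unrIntegers p) : ℂ_[p]) := by
    rw [← PowerSeries.coeff_zero_eq_constantCoeff_apply, PowerSeries.coeff_map,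
      PowerSeries.coeff_zero_eq_constantCoeff_apply, R1.coe_unrToCpInt]
  rw [hcoe, ← UnrSeries.eq_constantCoeff_of_hasValueAt_zero hu] at hlimv
  exact hlimv

/-- **(VC_p) ⟹ (VN_p)**: take norms (`‖u‖ = 1`). So (VN_p) is weaker than (VC_p), hence than H2∃⁻
(`valueContinuityAtErratumData_of_bdpValueCoreFrame`). [folklore] -/
theorem normContinuityAtErratumData_of_valueContinuity
    (hVC : ∀ [NeZero (W.conductorNorm ℤ)] (q : ℕ) [Fact q.Prime] (K : Type) [Field K] [NumberField K]
      (Dt : ModularParametrizationData W (W.conductorNorm ℤ))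
      (H : HeegnerDatum (W.conductorNorm ℤ) (NumberField.discr K)) (w₀ : InfinitePlace K)
      (P : (W.baseChange K).toAffine.Point), ErratumHypotheses W p → W.analyticRank = 1 →
      q ≠ p → Mult W q → ¬ W.HasSplitMultiplicativeReductionAtPrime q →
      ¬ p ∣ padicValInt q W.minimalDiscriminantInt → IsErratumField W K q →
      Cas20Standing K p (W.conductorNorm ℤ / p) →
      WeierstrassCurve.Affine.Point.map w₀.embedding.toRatAlgHom P = heegnerPointComplex Dt H →
      ¬ (p : ℤ) ∣ Dt.c → ¬ IsOfFinAddOrder P →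
      ∀ (κ : ZpExtension K p), κ.IsAnticyclotomic →
        ∀ (γ : Field.absoluteGaloisGroup K) [Fact (κ.IsTopGenerator γ)] (ι' : PadicAlgCl p ≃+* ℂ)
          (e : K →+* ℚ_[p]),
          (∀ k : 𝓞 K, k ∈ (primeOfEmbeddingDatum p ι' w₀.embedding).asIdeal ↔ ‖e (k : K)‖ < 1) →
          ∃ (ΩK : ℂ) (Ωp : ℂ_[p]) (u : ℂ_[p]), ΩK ≠ 0 ∧ Ωp ≠ 0 ∧ ‖u‖ = 1 ∧
            ∀ (φ : ℕ → HeckeCharacter K) (n : ℕ → ℕ) (r : ℕ → FramedGaloisRep K (PadicAlgCl p) 1),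
              (∀ k, 0 < n k) → (∀ k (v : HeightOneSpectrum (𝓞 K)), (φ k).IsUnramifiedAt v) →
              (∀ k, (φ k).HasInfinityType (fun _ ↦ (n k : ℤ)) (fun _ ↦ -(n k : ℤ))) →
              (∀ k, IsPAdicAvatarOf ι' (φ k) (r k)) → (∀ k, FactorsThroughZp κ (r k)) →
              Tendsto (fun k ↦ avatarValueAt (r k) γ) atTop (𝓝 1) →
              Tendsto (fun k ↦ ((ι'.symm (bdpInterpolationValue p Dt.f
                  (primeOfEmbeddingDatum p ι' w₀.embedding) (φ k) (n k) ΩK) : PadicAlgCl p) : ℂ_[p]) *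
                Ωp ^ (4 * n k)) atTop
                (𝓝 (u * (algebraMap ℚ_[p] ℂ_[p] (((1 : ℚ_[p]) - ((W.LFunction p : ℤ) : ℚ_[p]) *
                  (p : ℚ_[p])⁻¹) * logOmega W p e P)) ^ 2))) :
    ∀ [NeZero (W.conductorNorm ℤ)] (q : ℕ) [Fact q.Prime] (K : Type) [Field K] [NumberField K]
      (Dt : ModularParametrizationData W (W.conductorNorm ℤ))
      (H : HeegnerDatum (W.conductorNorm ℤ) (NumberField.discr K)) (w₀ : InfinitePlace K)
      (P : (W.baseChange K).toAffine.Point), ErratumHypotheses W p → W.analyticRank = 1 →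
      q ≠ p → Mult W q → ¬ W.HasSplitMultiplicativeReductionAtPrime q →
      ¬ p ∣ padicValInt q W.minimalDiscriminantInt → IsErratumField W K q →
      Cas20Standing K p (W.conductorNorm ℤ / p) →
      WeierstrassCurve.Affine.Point.map w₀.embedding.toRatAlgHom P = heegnerPointComplex Dt H →
      ¬ (p : ℤ) ∣ Dt.c → ¬ IsOfFinAddOrder P →
      ∀ (κ : ZpExtension K p), κ.IsAnticyclotomic →
        ∀ (γ : Field.absoluteGaloisGroup K) [Fact (κ.IsTopGenerator γ)] (ι' : PadicAlgCl p ≃+* ℂ)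
          (e : K →+* ℚ_[p]),
          (∀ k : 𝓞 K, k ∈ (primeOfEmbeddingDatum p ι' w₀.embedding).asIdeal ↔ ‖e (k : K)‖ < 1) →
          ∃ (ΩK : ℂ) (Ωp : ℂ_[p]), ΩK ≠ 0 ∧ Ωp ≠ 0 ∧
            ∀ (φ : ℕ → HeckeCharacter K) (n : ℕ → ℕ) (r : ℕ → FramedGaloisRep K (PadicAlgCl p) 1),
              (∀ k, 0 < n k) → (∀ k (v : HeightOneSpectrum (𝓞 K)), (φ k).IsUnramifiedAt v) →
              (∀ k, (φ k).HasInfinityType (fun _ ↦ (n k : ℤ)) (fun _ ↦ -(n k : ℤ))) →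
              (∀ k, IsPAdicAvatarOf ι' (φ k) (r k)) → (∀ k, FactorsThroughZp κ (r k)) →
              Tendsto (fun k ↦ avatarValueAt (r k) γ) atTop (𝓝 1) →
              Tendsto (fun k ↦ ‖((ι'.symm (bdpInterpolationValue p Dt.f
                  (primeOfEmbeddingDatum p ι' w₀.embedding) (φ k) (n k) ΩK) : PadicAlgCl p) : ℂ_[p]) *
                Ωp ^ (4 * n k)‖) atTop
                (𝓝 (‖algebraMap ℚ_[p] ℂ_[p] (((1 : ℚ_[p]) - ((W.LFunction p : ℤ) : ℚ_[p]) *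
                  (p : ℚ_[p])⁻¹) * logOmega W p e P)‖ ^ 2)) := by
  intro _ q _ K _ _ Dt H w₀ P hE hr hqp hmq hns hvq hK hCas hP hc hinf κ hκ γ _ ι' e he
  obtain ⟨ΩK, Ωp, u, hΩK, hΩp, hu, hcont⟩ :=
    hVC q K Dt H w₀ P hE hr hqp hmq hns hvq hK hCas hP hc hinf κ hκ γ ι' e he
  refine ⟨ΩK, Ωp, hΩK, hΩp, fun φ n r hn hunr hinf' hr hrκ hlim ↦ ?_⟩
  have h := (hcont φ n r hn hunr hinf' hr hrκ hlim).norm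
  rwa [norm_mul, hu, one_mul, norm_pow] at h

end Weaker

end Summit.BirchSwinnertonDyer.BirchSwinnertonDyer.Theorems

end
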